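import Literature.Probability.LatticeModels.SpaceTimeTorusCharacters
import Literature.LinearAlgebra.Matrix.HermitianCfcComplexification
import HarnessLib

/-!
# Functions of a translation-invariant form on the space-time torus: the character expansion of
# `g(Q)_{xy}`, the symbol floor `q̂ ≥ c₀ε` from a Dirichlet lower bound, and INCREMENT (discrete
# gradient) bounds by momentum sums

Topic `Probability/LatticeModels`, namespace `Literature.Probability.LatticeModels`.  Sequel to
`SpaceTimeTorusCharacters.lean` (characters `χ_{(k,q)}` of `Λ = (ℤ/L)^d × ℤ/M`, the unitary `V`, the
symbol `p̂`, `P = V diag(p̂) V*` for translation-invariant `P`).  For a REAL SYMMETRIC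
TRANSLATION-INVARIANT matrix `Q` on `Λ` and any `g : ℝ → ℝ`, the matrix function `g(Q)` (Mathlib
`cfc`, through `cfc_eq_conj_diagonal` of `HermitianCfcDiagonalForm.lean` and `cfc_map_ofReal` of
`HermitianCfcComplexification.lean`) has the plane-wave expansion

  `g(Q)_{xy} = |Λ|⁻¹ Σ_k g(q̂_k) χ_k(x) conj χ_k(y)`      (`cfc_apply_eq_sum_stChar`),

the finite-volume form of "`C(x) = ∫ ĝ(k) e^{ik·x} đk`" for every function of a convolution
operator (Friedli–Velenik 2017, §8.4, (8.41)–(8.44) for the lattice Green function; Bauerschmidt–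
Brydges–Slade 2019, §1.5.1).  Consequences:

* `mulVec_stChar` — `Q χ_k = q̂_k χ_k` (every character is an eigenvector; CST 2018 Cor. 2.4.11);
* **`re_stSymbol_ge_of_lower`** — a Dirichlet lower bound `c₀ Σ_iΣ_s(u_s - u_{s+E_i})² ≤ u·Qu` on
  real fields gives the SYMBOL FLOOR `q̂_k ≥ c₀ Σ_i 2(1 - Re χ_k(E_i))` (test `u = Re χ_k, Im χ_k`);
* **`norm_cfc_apply_le_sum_stChar`**, **`norm_cfc_apply_sub_le`**, **`norm_cfc_apply_sub_sub_le`**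
  — `|g(Q)_{xy}| ≤ |Λ|⁻¹Σ_k|g(q̂_k)|`, the INCREMENT bound
  `|g(Q)_{x+e,y} - g(Q)_{xy}| ≤ |Λ|⁻¹ Σ_k |g(q̂_k)|·|1 - χ_k(e)|` and the mixed second increment
  `≤ |Λ|⁻¹ Σ_k |g(q̂_k)|·|1-χ_k(e)|·|1-χ_k(e')|` (each discrete gradient costs a factor
  `|1 - χ_k(e)| = (2(1 - Re χ_k(e)))^{1/2}` in the momentum sum — the source of the extra decay
  `L^{-|α|j}` of `∇^αC_j` in finite-range decompositions, BBS 2019 Prop. 3.3.1 / Bauerschmidt 2013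
  Thm. 1.2, here for a general translation-invariant form);
* `norm_cfc_apply_sub_le_of_antitone` — with the symbol floor and an antitone majorant `G ≥ g ≥ 0`
  on `[0,∞)`: `|g(Q)_{x+e,y} - g(Q)_{xy}| ≤ |Λ|⁻¹ Σ_k G(c₀ε_k)·|1 - χ_k(e)|`, `ε_k = Σ_i 2(1-Re χ_k(E_i))`.

## References

* S. Friedli, Y. Velenik, *Statistical Mechanics of Lattice Systems* (CUP 2017), §8.4. [FriedliVelenik2017]
* T. Ceccherini-Silberstein, F. Scarabotti, F. Tolli, *Discrete Harmonic Analysis* (CUP 2018),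
  §2.4, Cor. 2.4.11. [CeccherinisilbersteScarabottiTolli2018]
* R. Bauerschmidt, D. C. Brydges, G. Slade, LNM 2242 (2019), §1.5.1, Prop. 3.3.1. [BauerschmidtBrydgesSlade2019RG]
-/

noncomputable section

open Matrix Finset
open scoped ComplexConjugate Real MatrixOrder ComplexOrder
open Literature.LinearAlgebra.Matrix

namespace Literature.Probability.LatticeModels

variable {d L M : ℕ} [NeZero L] [NeZero M]

/-! ### Characters are eigenvectors; unit modulus -/

/-- `‖χ_k(x)‖ = 1`. [folklore] -/
theorem norm_stChar (k x : TorusSite d L × ZMod M) : ‖stChar k x‖ = 1 := by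
  have h := stChar_mul_conj k x
  rw [Complex.mul_conj] at h
  have h1 : Complex.normSq (stChar k x) = 1 := by exact_mod_cast h
  have h2 : ‖stChar k x‖ ^ 2 = 1 := by rw [Complex.sq_norm]; exact h1
  nlinarith [norm_nonneg (stChar k x)]

/-- `|1 - z|² = 2(1 - Re z)` for `|z| = 1`; in particular for character values. [folklore] -/
theorem normSq_one_sub_stChar (k e : TorusSite d L × ZMod M) :
    ‖1 - stChar k e‖ ^ 2 = 2 * (1 - (stChar k e).re) := by
  have h1 : ‖stChar k e‖ ^ 2 = 1 := by rw [norm_stChar, one_pow]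
  rw [← Complex.normSq_eq_norm_sq, Complex.normSq_apply] at h1 ⊢
  simp only [Complex.sub_re, Complex.one_re, Complex.sub_im, Complex.one_im, zero_sub]
  nlinarith

/-- **Every character is an eigenvector of a translation-invariant matrix**: `P χ_k = p̂(k) χ_k`.
[cite: CeccherinisilbersteScarabottiTolli2018, §2.4, Corollary 2.4.11] -/
theorem mulVec_stChar {P : Matrix (TorusSite d L × ZMod M) (TorusSite d L × ZMod M) ℂ}
    (hPt : ∀ a x y, P (x + a) (y + a) = P x y) (k : TorusSite d L × ZMod M) :
    P *ᵥ (fun x => stChar k x) = fun x => stSymbol P k * stChar k x := by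
  funext x
  simp only [Matrix.mulVec, dotProduct, stSymbol, Finset.sum_mul]
  rw [← Equiv.sum_comp (Equiv.addRight x) (fun y => P x y * stChar k y)]
  refine Finset.sum_congr rfl fun n _ => ?_
  simp only [Equiv.coe_addRight]
  have h := hPt x 0 n
  rw [zero_add] at h
  rw [h, stChar_add_right]
  ring

/-! ### The symbol floor from a Dirichlet lower bound -/

/-- Real and imaginary parts of the eigenvector equation for a REAL translation-invariant matrix
with real symbol: `Q (Re χ_k) = q̂_k Re χ_k`, `Q (Im χ_k) = q̂_k Im χ_k`. [folklore] -/
theorem mulVec_re_im_stChar {Q : Matrix (TorusSite d L × ZMod M) (TorusSite d L × ZMod M) ℝ}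
    (hQt : ∀ a x y, Q (x + a) (y + a) = Q x y) (hQs : ∀ x y, Q x y = Q y x)
    (k : TorusSite d L × ZMod M) :
    (Q *ᵥ (fun x => (stChar k x).re) =
        fun x => (stSymbol (Q.map (algebraMap ℝ ℂ)) k).re * (stChar k x).re) ∧
      (Q *ᵥ (fun x => (stChar k x).im) =
        fun x => (stSymbol (Q.map (algebraMap ℝ ℂ)) k).re * (stChar k x).im) := by
  set P : Matrix (TorusSite d L × ZMod M) (TorusSite d L × ZMod M) ℂ := Q.map (algebraMap ℝ ℂ)
    with hP
  have hPt : ∀ a x y, P (x + a) (y + a) = P x y := fun a x y => by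
    simp only [hP, Matrix.map_apply, hQt]
  have hreal : ∀ x y, conj (P x y) = P x y := fun x y => by
    rw [hP, Matrix.map_apply]; exact Complex.conj_ofReal _
  have hsymm : ∀ x y, P x y = P y x := fun x y => by simp only [hP, Matrix.map_apply, hQs]
  have hsreal : ((stSymbol P k).re : ℂ) = stSymbol P k :=
    Complex.conj_eq_iff_re.mp (conj_stSymbol hPt hreal hsymm k)
  have hev := mulVec_stChar hPt k
  -- compare real and imaginary parts of `P χ = p̂ χ`, entrywise
  have hentry : ∀ x, (∑ y, (Q x y : ℂ) * stChar k y) = stSymbol P k * stChar k x := by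
    intro x
    have := congrFun hev x
    simpa [Matrix.mulVec, dotProduct, hP, Matrix.map_apply] using this
  constructor
  · funext x
    have h := congrArg Complex.re (hentry x)
    rw [← hsreal] at h
    simp only [Complex.re_sum, Complex.mul_re, Complex.ofReal_re, Complex.ofReal_im, zero_mul,
      sub_zero] at h
    simpa [Matrix.mulVec, dotProduct] using h
  · funext x
    have h := congrArg Complex.im (hentry x)
    rw [← hsreal] at h
    simp only [Complex.im_sum, Complex.mul_im, Complex.ofReal_re, Complex.ofReal_im, zero_mul,
      add_zero] at h
    simpa [Matrix.mulVec, dotProduct] using h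

/-- `Σ_x ((Re χ_k(x))² + (Im χ_k(x))²) = |Λ|`. [folklore] -/
theorem sum_re_sq_add_im_sq_stChar (k : TorusSite d L × ZMod M) :
    ∑ x : TorusSite d L × ZMod M, ((stChar k x).re ^ 2 + (stChar k x).im ^ 2) =
      (Fintype.card (TorusSite d L × ZMod M) : ℝ) := by
  have h : ∀ x : TorusSite d L × ZMod M, (stChar k x).re ^ 2 + (stChar k x).im ^ 2 = 1 := by
    intro x
    have h1 : ‖stChar k x‖ ^ 2 = 1 := by rw [norm_stChar, one_pow]
    rw [← Complex.normSq_eq_norm_sq, Complex.normSq_apply] at h1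
    nlinarith
  simp_rw [h]
  rw [Finset.sum_const, Finset.card_univ, nsmul_eq_mul, mul_one]

/-- The Dirichlet form of `Re χ_k` plus that of `Im χ_k` along a step `e` is `|Λ|·2(1 - Re χ_k(e))`.
[folklore] -/
theorem dirichlet_re_add_im_stChar (k e : TorusSite d L × ZMod M) :
    ∑ s : TorusSite d L × ZMod M, (((stChar k s).re - (stChar k (s + e)).re) ^ 2 +
        ((stChar k s).im - (stChar k (s + e)).im) ^ 2) =
      (Fintype.card (TorusSite d L × ZMod M) : ℝ) * (2 * (1 - (stChar k e).re)) := by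
  have h : ∀ s : TorusSite d L × ZMod M, ((stChar k s).re - (stChar k (s + e)).re) ^ 2 +
      ((stChar k s).im - (stChar k (s + e)).im) ^ 2 = 2 * (1 - (stChar k e).re) := by
    intro s
    have hn : ‖stChar k s - stChar k (s + e)‖ ^ 2 = 2 * (1 - (stChar k e).re) := by
      rw [stChar_add_right, ← mul_one_sub, norm_mul, norm_stChar, one_mul, normSq_one_sub_stChar]
    rw [← Complex.normSq_eq_norm_sq, Complex.normSq_apply] at hn
    simp only [Complex.sub_re, Complex.sub_im] at hn
    nlinarith
  simp_rw [h]
  rw [Finset.sum_const, Finset.card_univ, nsmul_eq_mul]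

/-- **THE SYMBOL FLOOR.**  If a real symmetric translation-invariant `Q` satisfies the Dirichlet
lower bound `c₀ Σ_i Σ_s (u_s - u_{s+E_i})² ≤ u·Qu` for all real `u`, then its symbol satisfies
`q̂_k ≥ c₀ · Σ_i 2(1 - Re χ_k(E_i))` for every momentum `k` (test the bound at `Re χ_k` and `Im χ_k`
and add: both are eigenvectors with eigenvalue `q̂_k`). [cite: FriedliVelenik2017, §8.4 (the symbol of −Δ is 2Σ(1 − cos k_i))] -/
theorem re_stSymbol_ge_of_lower {Q : Matrix (TorusSite d L × ZMod M) (TorusSite d L × ZMod M) ℝ}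
    (hQt : ∀ a x y, Q (x + a) (y + a) = Q x y) (hQs : ∀ x y, Q x y = Q y x)
    {m : ℕ} (E : Fin m → TorusSite d L × ZMod M) {c₀ : ℝ}
    (hlow : ∀ u, c₀ * ∑ i, ∑ s, (u s - u (s + E i)) ^ 2 ≤ u ⬝ᵥ Q *ᵥ u)
    (k : TorusSite d L × ZMod M) :
    c₀ * ∑ i, 2 * (1 - (stChar k (E i)).re) ≤ (stSymbol (Q.map (algebraMap ℝ ℂ)) k).re := by
  set q : ℝ := (stSymbol (Q.map (algebraMap ℝ ℂ)) k).re with hq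
  obtain ⟨hre, him⟩ := mulVec_re_im_stChar hQt hQs k
  set a : TorusSite d L × ZMod M → ℝ := fun x => (stChar k x).re with ha
  set b : TorusSite d L × ZMod M → ℝ := fun x => (stChar k x).im with hb
  have hN : (0 : ℝ) < Fintype.card (TorusSite d L × ZMod M) := by
    exact_mod_cast Fintype.card_pos
  -- the Rayleigh quotients
  have hqa : a ⬝ᵥ Q *ᵥ a = q * ∑ x, a x ^ 2 := by
    rw [hre, dotProduct, Finset.mul_sum]
    exact Finset.sum_congr rfl fun x _ => by simp only [ha]; ring
  have hqb : b ⬝ᵥ Q *ᵥ b = q * ∑ x, b x ^ 2 := by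
    rw [him, dotProduct, Finset.mul_sum]
    exact Finset.sum_congr rfl fun x _ => by simp only [hb]; ring
  have hsum : a ⬝ᵥ Q *ᵥ a + b ⬝ᵥ Q *ᵥ b = q * Fintype.card (TorusSite d L × ZMod M) := by
    rw [hqa, hqb, ← mul_add, ← Finset.sum_add_distrib, sum_re_sq_add_im_sq_stChar]
  -- the Dirichlet forms
  have hD : ∑ i, ∑ s, (a s - a (s + E i)) ^ 2 + ∑ i, ∑ s, (b s - b (s + E i)) ^ 2 =
      Fintype.card (TorusSite d L × ZMod M) * ∑ i, 2 * (1 - (stChar k (E i)).re) := by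
    rw [← Finset.sum_add_distrib, Finset.mul_sum]
    refine Finset.sum_congr rfl fun i _ => ?_
    rw [← Finset.sum_add_distrib]
    exact dirichlet_re_add_im_stChar k (E i)
  have h1 := hlow a
  have h2 := hlow b
  have key : c₀ * (Fintype.card (TorusSite d L × ZMod M) * ∑ i, 2 * (1 - (stChar k (E i)).re)) ≤
      q * Fintype.card (TorusSite d L × ZMod M) := by
    rw [← hD, ← hsum, mul_add]
    exact add_le_add h1 h2
  have key' : Fintype.card (TorusSite d L × ZMod M) * (c₀ * ∑ i, 2 * (1 - (stChar k (E i)).re)) ≤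
      Fintype.card (TorusSite d L × ZMod M) * q := by nlinarith
  exact le_of_mul_le_mul_left key' hN

/-! ### The character expansion of `g(Q)` and increment bounds -/

/-- **The plane-wave expansion of a function of a translation-invariant real symmetric matrix**:
`g(Q)_{xy} = (Σ_k g(q̂_k) χ_k(x) conj χ_k(y)) / |Λ|` (as complex numbers; `q̂` the symbol of the
complexification). [cite: FriedliVelenik2017, §8.4 ((8.41)–(8.44): functions of the Laplacian in Fourier variables)] -/
theorem cfc_apply_eq_sum_stChar {Q : Matrix (TorusSite d L × ZMod M) (TorusSite d L × ZMod M) ℝ}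
    (hQ : Q.IsHermitian) (hQt : ∀ a x y, Q (x + a) (y + a) = Q x y) (g : ℝ → ℝ)
    (x y : TorusSite d L × ZMod M) :
    ((cfc g Q x y : ℝ) : ℂ) =
      (∑ k, (g (stSymbol (Q.map (algebraMap ℝ ℂ)) k).re : ℂ) * stChar k x * conj (stChar k y)) /
        ((L : ℂ) ^ d * M) := by
  have hQs : ∀ x y, Q x y = Q y x := fun x y => by
    have := hQ.apply x y
    rw [star_trivial] at this
    exact this.symm
  set P : Matrix (TorusSite d L × ZMod M) (TorusSite d L × ZMod M) ℂ := Q.map (algebraMap ℝ ℂ)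
    with hP
  have hPt : ∀ a x y, P (x + a) (y + a) = P x y := fun a x y => by
    simp only [hP, Matrix.map_apply, hQt]
  have hreal : ∀ x y, conj (P x y) = P x y := fun x y => by
    rw [hP, Matrix.map_apply]; exact Complex.conj_ofReal _
  have hsymm : ∀ x y, P x y = P y x := fun x y => by simp only [hP, Matrix.map_apply, hQs]
  have hmap : ((cfc g Q x y : ℝ) : ℂ) = (cfc g P) x y := by
    have := congrFun (congrFun (cfc_map_ofReal hQ g) x) y
    rw [Matrix.map_apply] at this
    exact this
  rw [hmap, cfc_apply_eq_sum stCharMatrix_mem_unitaryGroup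
    (eq_conj_diagonal_re_stSymbol hPt hreal hsymm) g x y]
  obtain ⟨hsq, hne⟩ := sqrt_card_mul_self (d := d) (L := L) (M := M)
  rw [Finset.sum_div]
  refine Finset.sum_congr rfl fun k _ => ?_
  simp only [stCharMatrix, Matrix.of_apply, star_div₀, RCLike.star_def, Complex.conj_ofReal]
  rw [← hsq]
  field_simp
  exact mul_right_comm _ _ _

/-- **`|g(Q)_{xy}| ≤ |Λ|⁻¹ Σ_k |g(q̂_k)|`** for a translation-invariant real symmetric `Q`.
[cite: BauerschmidtBrydgesSlade2019RG, §1.5.1 (bounds on the Green function through its Fourier representation)] -/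
theorem norm_cfc_apply_le_sum_stChar
    {Q : Matrix (TorusSite d L × ZMod M) (TorusSite d L × ZMod M) ℝ}
    (hQ : Q.IsHermitian) (hQt : ∀ a x y, Q (x + a) (y + a) = Q x y) (g : ℝ → ℝ)
    (x y : TorusSite d L × ZMod M) :
    |cfc g Q x y| ≤ (Fintype.card (TorusSite d L × ZMod M) : ℝ)⁻¹ *
      ∑ k, |g (stSymbol (Q.map (algebraMap ℝ ℂ)) k).re| := by
  have h := cfc_apply_eq_sum_stChar hQ hQt g x y
  have hN : ((L : ℂ) ^ d * M) = ((Fintype.card (TorusSite d L × ZMod M) : ℝ) : ℂ) := by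
    rw [card_spaceTime]; push_cast; ring
  have hNpos : (0 : ℝ) < Fintype.card (TorusSite d L × ZMod M) := by exact_mod_cast Fintype.card_pos
  have hnorm : |cfc g Q x y| = ‖((cfc g Q x y : ℝ) : ℂ)‖ := by
    rw [Complex.norm_real, Real.norm_eq_abs]
  rw [hnorm, h, hN, norm_div, Complex.norm_real, Real.norm_eq_abs, abs_of_pos hNpos,
    div_eq_inv_mul]
  refine mul_le_mul_of_nonneg_left ((norm_sum_le _ _).trans (le_of_eq ?_)) (by positivity)
  refine Finset.sum_congr rfl fun k _ => ?_
  rw [norm_mul, norm_mul, Complex.norm_real, Real.norm_eq_abs, RCLike.norm_conj, norm_stChar,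
    norm_stChar, mul_one, mul_one]

/-- **THE INCREMENT (DISCRETE GRADIENT) BOUND**:
`|g(Q)_{x+e,y} - g(Q)_{xy}| ≤ |Λ|⁻¹ Σ_k |g(q̂_k)| · |1 - χ_k(e)|` — each discrete gradient costs
a factor `|1 - χ_k(e)| = (2(1 - Re χ_k(e)))^{1/2}` in the momentum sum.
[cite: BauerschmidtBrydgesSlade2019RG, Prop. 3.3.1 (gradient estimates ∇^α C_j through the Fourier representation)] -/
theorem norm_cfc_apply_sub_le
    {Q : Matrix (TorusSite d L × ZMod M) (TorusSite d L × ZMod M) ℝ}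
    (hQ : Q.IsHermitian) (hQt : ∀ a x y, Q (x + a) (y + a) = Q x y) (g : ℝ → ℝ)
    (x y e : TorusSite d L × ZMod M) :
    |cfc g Q (x + e) y - cfc g Q x y| ≤ (Fintype.card (TorusSite d L × ZMod M) : ℝ)⁻¹ *
      ∑ k, |g (stSymbol (Q.map (algebraMap ℝ ℂ)) k).re| * ‖1 - stChar k e‖ := by
  have h1 := cfc_apply_eq_sum_stChar hQ hQt g (x + e) y
  have h2 := cfc_apply_eq_sum_stChar hQ hQt g x y
  have hN : ((L : ℂ) ^ d * M) = ((Fintype.card (TorusSite d L × ZMod M) : ℝ) : ℂ) := by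
    rw [card_spaceTime]; push_cast; ring
  have hNpos : (0 : ℝ) < Fintype.card (TorusSite d L × ZMod M) := by exact_mod_cast Fintype.card_pos
  have hdiff : (((cfc g Q (x + e) y - cfc g Q x y : ℝ)) : ℂ) =
      (∑ k, (g (stSymbol (Q.map (algebraMap ℝ ℂ)) k).re : ℂ) * (stChar k x * (stChar k e - 1)) *
        conj (stChar k y)) / ((Fintype.card (TorusSite d L × ZMod M) : ℝ) : ℂ) := by
    push_cast
    rw [h1, h2, hN, ← sub_div, ← Finset.sum_sub_distrib]
    congr 1
    refine Finset.sum_congr rfl fun k _ => ?_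
    rw [stChar_add_right]
    ring
  have hnorm : |cfc g Q (x + e) y - cfc g Q x y| = ‖((cfc g Q (x + e) y - cfc g Q x y : ℝ) : ℂ)‖ := by
    rw [Complex.norm_real, Real.norm_eq_abs]
  rw [hnorm, hdiff, norm_div, Complex.norm_real, Real.norm_eq_abs, abs_of_pos hNpos, div_eq_inv_mul]
  refine mul_le_mul_of_nonneg_left ((norm_sum_le _ _).trans (le_of_eq ?_)) (by positivity)
  refine Finset.sum_congr rfl fun k _ => ?_
  rw [norm_mul, norm_mul, norm_mul, Complex.norm_real, Real.norm_eq_abs, RCLike.norm_conj,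
    norm_stChar, norm_stChar, one_mul, mul_one, norm_sub_rev]

/-- **The mixed second increment**:
`|g(Q)_{x+e,y+e'} - g(Q)_{x+e,y} - g(Q)_{x,y+e'} + g(Q)_{xy}| ≤ |Λ|⁻¹ Σ_k |g(q̂_k)|·|1-χ_k(e)|·|1-χ_k(e')|`.
[cite: BauerschmidtBrydgesSlade2019RG, Prop. 3.3.1 (gradient estimates)] -/
theorem norm_cfc_apply_sub_sub_le
    {Q : Matrix (TorusSite d L × ZMod M) (TorusSite d L × ZMod M) ℝ}
    (hQ : Q.IsHermitian) (hQt : ∀ a x y, Q (x + a) (y + a) = Q x y) (g : ℝ → ℝ)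
    (x y e e' : TorusSite d L × ZMod M) :
    |cfc g Q (x + e) (y + e') - cfc g Q (x + e) y - cfc g Q x (y + e') + cfc g Q x y| ≤
      (Fintype.card (TorusSite d L × ZMod M) : ℝ)⁻¹ *
        ∑ k, |g (stSymbol (Q.map (algebraMap ℝ ℂ)) k).re| * ‖1 - stChar k e‖ * ‖1 - stChar k e'‖ := by
  have h11 := cfc_apply_eq_sum_stChar hQ hQt g (x + e) (y + e')
  have h10 := cfc_apply_eq_sum_stChar hQ hQt g (x + e) y
  have h01 := cfc_apply_eq_sum_stChar hQ hQt g x (y + e')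
  have h00 := cfc_apply_eq_sum_stChar hQ hQt g x y
  have hN : ((L : ℂ) ^ d * M) = ((Fintype.card (TorusSite d L × ZMod M) : ℝ) : ℂ) := by
    rw [card_spaceTime]; push_cast; ring
  have hNpos : (0 : ℝ) < Fintype.card (TorusSite d L × ZMod M) := by exact_mod_cast Fintype.card_pos
  have hdiff : (((cfc g Q (x + e) (y + e') - cfc g Q (x + e) y - cfc g Q x (y + e') + cfc g Q x y : ℝ))
      : ℂ) =
      (∑ k, (g (stSymbol (Q.map (algebraMap ℝ ℂ)) k).re : ℂ) *
        (stChar k x * (stChar k e - 1)) * conj (stChar k y * (stChar k e' - 1))) /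
          ((Fintype.card (TorusSite d L × ZMod M) : ℝ) : ℂ) := by
    push_cast
    rw [h11, h10, h01, h00, hN, ← sub_div, ← sub_div, ← add_div, ← Finset.sum_sub_distrib,
      ← Finset.sum_sub_distrib, ← Finset.sum_add_distrib]
    congr 1
    refine Finset.sum_congr rfl fun k _ => ?_
    rw [stChar_add_right, stChar_add_right, map_mul, map_mul, map_sub, map_one]
    ring
  have hnorm : |cfc g Q (x + e) (y + e') - cfc g Q (x + e) y - cfc g Q x (y + e') + cfc g Q x y| =
      ‖((cfc g Q (x + e) (y + e') - cfc g Q (x + e) y - cfc g Q x (y + e') + cfc g Q x y : ℝ) : ℂ)‖ := by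
    rw [Complex.norm_real, Real.norm_eq_abs]
  rw [hnorm, hdiff, norm_div, Complex.norm_real, Real.norm_eq_abs, abs_of_pos hNpos, div_eq_inv_mul]
  refine mul_le_mul_of_nonneg_left ((norm_sum_le _ _).trans (le_of_eq ?_)) (by positivity)
  refine Finset.sum_congr rfl fun k _ => ?_
  rw [norm_mul, norm_mul, norm_mul, map_mul, norm_mul, Complex.norm_real, Real.norm_eq_abs,
    RCLike.norm_conj, RCLike.norm_conj, norm_stChar, norm_stChar, one_mul, one_mul, norm_sub_rev,
    norm_sub_rev (stChar k e')]

/-- **Increment bound with the symbol floor and an antitone majorant.**  If moreover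
`c₀ Σ_iΣ_s(u_s - u_{s+E_i})² ≤ u·Qu` (`c₀` real) and `0 ≤ g ≤ G` on `[0,∞)` with `G` antitone on
`[0,∞)` and the symbol nonnegative (e.g. `Q ⪰ 0`), then
`|g(Q)_{x+e,y} - g(Q)_{xy}| ≤ |Λ|⁻¹ Σ_k G(c₀·Σ_i 2(1 - Re χ_k(E_i))) · |1 - χ_k(e)|`.
[cite: BauerschmidtBrydgesSlade2019RG, Prop. 3.3.1] -/
theorem norm_cfc_apply_sub_le_of_antitone
    {Q : Matrix (TorusSite d L × ZMod M) (TorusSite d L × ZMod M) ℝ}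
    (hQ : Q.IsHermitian) (hQt : ∀ a x y, Q (x + a) (y + a) = Q x y)
    {m : ℕ} (E : Fin m → TorusSite d L × ZMod M) {c₀ : ℝ}
    (hlow : ∀ u, c₀ * ∑ i, ∑ s, (u s - u (s + E i)) ^ 2 ≤ u ⬝ᵥ Q *ᵥ u)
    (hpos : ∀ k, 0 ≤ (stSymbol (Q.map (algebraMap ℝ ℂ)) k).re)
    {g G : ℝ → ℝ} (hg0 : ∀ μ, 0 ≤ μ → 0 ≤ g μ) (hgG : ∀ μ, 0 ≤ μ → g μ ≤ G μ)
    (hG : AntitoneOn G (Set.Ici 0)) (hc : ∀ k, 0 ≤ c₀ * ∑ i, 2 * (1 - (stChar k (E i)).re))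
    (x y e : TorusSite d L × ZMod M) :
    |cfc g Q (x + e) y - cfc g Q x y| ≤ (Fintype.card (TorusSite d L × ZMod M) : ℝ)⁻¹ *
      ∑ k, G (c₀ * ∑ i, 2 * (1 - (stChar k (E i)).re)) * ‖1 - stChar k e‖ := by
  have hQs : ∀ x y, Q x y = Q y x := fun x y => by
    have := hQ.apply x y
    rw [star_trivial] at this
    exact this.symm
  refine (norm_cfc_apply_sub_le hQ hQt g x y e).trans ?_
  refine mul_le_mul_of_nonneg_left (Finset.sum_le_sum fun k _ => ?_) (by positivity)
  refine mul_le_mul_of_nonneg_right ?_ (norm_nonneg _)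
  have hq := hpos k
  rw [abs_of_nonneg (hg0 _ hq)]
  refine (hgG _ hq).trans ?_
  exact hG (Set.mem_Ici.mpr (hc k)) (Set.mem_Ici.mpr hq) (re_stSymbol_ge_of_lower hQt hQs E hlow k)

end Literature.Probability.LatticeModels

end
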